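import Mathlib
import Summits.BirchSwinnertonDyer.BirchSwinnertonDyer.Theses.VerticalContact
import Literature.NumberTheory.Automorphic.BrandtDefiniteSetupLite

/-!
# Sketch — crux ideas for `VerticalContact` (stmt-BirchSwinnertonDyer-18431), ideator 2, round 1

First lemmas of three crux idea cards (must elaborate; the easy ones are proved):

* §0  the crux's data / form / period / depth clauses packaged over the Lite names
      (verbatim the strategist's `CensusSketch.lean`, copied so this file is self-contained);
* §1  card `first-layer-depth`: the ultrametric Taylor (Strassmann) bound
      `‖∑ bₙ xⁿ‖ ≤ ‖x‖^m` when `b₀ = … = b_{m-1} = 0`, its contrapositive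
      ("one value bounds the order of vanishing"), the transferred statement `FirstLayerDepth`
      (= C⁺: ONE first-layer Gross period of 𝔓-depth ≤ r̃_an, no constant), the germ-supply
      predicate `GermSupplyAt` and the transfer statement `OneValueTransfer`;
* §2  card `hida-tangent-cup`: `TwoRefinementDichotomy` (proved);
* §3  card `diagonal-coleman-primitive`: `RubinLeadingTermIdentity` (proved).
-/

noncomputable section

set_option linter.dupNamespace false
set_option linter.unusedVariables false

open scoped BigOperators NumberField Classical

namespace Summit.BirchSwinnertonDyer.BirchSwinnertonDyer.Cruxes.VerticalContact.Ideate2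

open Literature.NumberTheory.Automorphic Literature.NumberTheory.Automorphic.Brandt

/-! ### §0 The crux clauses over the Lite names (verbatim `CensusSketch.lean`) -/

/-- Admissible contact datum (conjuncts of the route decl not mentioning the coefficient field). -/
def Datum (W : WeierstrassCurve ℚ) [W.IsElliptic] [W.IsGloballyMinimal] (p : ℕ) [Fact p.Prime]
    (K : Type) [Field K] [NumberField K]
    (Nplus Nminus : ℕ) (a b : ℚ) (O : Subring (QuaternionAlgebra ℚ a 0 b))
    (ψ : K →ₐ[ℚ] QuaternionAlgebra ℚ a 0 b) (I₁ : Submodule ℤ (QuaternionAlgebra ℚ a 0 b))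
    (a₀ : ClassGroup (𝓞 K) → nonZeroDivisors (Ideal (𝓞 K))) (α : ClassGroup (𝓞 K) → 𝓞 K) : Prop :=
  let hK := NumberField.classNumber K
  let dK := NumberField.discr K
  let spl : ℕ → ℕ := fun q => ((Ideal.span {(q : ℤ)}).primesOver (𝓞 K)).ncard
  (5 ≤ p ∧ W.HasGoodReductionAtPrime p ∧ ¬ (p : ℤ) ∣ W.frobeniusTrace p ∧
      W.HasSurjectiveModNGaloisRep p ∧ ¬ p ∣ 6 * hK ∧ Int.gcd dK (W.conductorNorm ℤ * p) = 1) ∧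
  (Module.finrank ℚ K = 2 ∧ NumberField.IsTotallyComplex K ∧ dK < -4 ∧ spl p = 2) ∧
  (W.conductorNorm ℤ = Nplus * Nminus ∧ Nat.Coprime Nplus Nminus ∧ Squarefree Nminus ∧
      Odd Nminus.primeFactors.card ∧ (∀ q : ℕ, q.Prime → q ∣ Nplus → spl q = 2) ∧
      (∀ q : ℕ, q.Prime → q ∣ Nminus → spl q = 1 ∧ ¬ (p : ℤ) ∣ padicValRat q W.Δ)) ∧
  (a < 0 ∧ b < 0 ∧ IsRamifiedExactlyAtLite a b Nminus ∧ IsEichlerOrderLite O Nplus) ∧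
  (IsGrossPointLite O ψ I₁ ∧ ∀ c, ClassGroup.mk0 (a₀ c) = c ∧
      IsCoprime (a₀ c).1 (Ideal.span {(p : 𝓞 K)}) ∧ Ideal.span {α c} = (a₀ c).1 ^ hK ∧
      IsGrossPointLite O ψ (grossTranslateLite ψ (a₀ c).1 I₁) ∧
      IsCommensurablePrimeToLite O p (grossTranslateLite ψ (a₀ c).1 I₁))

/-- Admissible weight-`k` form at depth `N` with its coefficient data (verbatim). -/
def Form (W : WeierstrassCurve ℚ) [W.IsElliptic] [W.IsGloballyMinimal] (p : ℕ) [Fact p.Prime]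
    (K : Type) [Field K] [NumberField K]
    (Nplus Nminus : ℕ) (a b : ℚ) (O : Subring (QuaternionAlgebra ℚ a 0 b))
    (ψ : K →ₐ[ℚ] QuaternionAlgebra ℚ a 0 b) (N : ℕ)
    (F : Type) [Field F] [NumberField F] [Algebra K F]
    (𝔓 : IsDedekindDomain.HeightOneSpectrum (𝓞 F))
    (ι : QuaternionAlgebra ℚ a 0 b →ₐ[ℚ] Matrix (Fin 2) (Fin 2) F) (e e' : Fin 2 → F)
    (k : ℕ) (lam : ℕ → F)
    (Φ : Submodule ℤ (QuaternionAlgebra ℚ a 0 b) → MvPolynomial (Fin 2) F) : Prop :=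
  let val := 𝔓.valuation F
  let hK := NumberField.classNumber K
  ((p : 𝓞 F) ∈ 𝔓.asIdeal ∧ ∀ x ∈ O, ∀ i j, val (ι x i j) ≤ 1) ∧
  ((∀ t, Matrix.vecMul e (ι (ψ t)) = (algebraMap K F t) • e) ∧
      (∀ t, Matrix.vecMul e' (ι (ψ t)) = (algebraMap K F (Algebra.trace ℚ K t) - algebraMap K F t) • e') ∧
      (∀ i, val (e i) ≤ 1) ∧ (∀ i, val (e' i) ≤ 1) ∧ val (e 0 * e' 1 - e 1 * e' 0) = 1) ∧
  ((2 < k ∧ 2 * (p - 1) * p ^ N ∣ k - 2 ∧ 2 * hK ∣ k - 2) ∧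
    (∀ I ∈ rightIdealsLite O, (Φ I).IsHomogeneous (k - 2)) ∧
    (∀ (β : (QuaternionAlgebra ℚ a 0 b)ˣ), ∀ I ∈ rightIdealsLite O,
        Φ (I.map (AddMonoidHom.mulLeft β.1).toIntLinearMap) = coeffActionLite ι β (Φ I)) ∧
    (∀ q : ℕ, q.Prime → ¬ q ∣ Nplus * Nminus → ∀ I ∈ rightIdealsLite O,
        ∑ᶠ J ∈ heckeNeighboursLite O q I, Φ J = lam q • Φ I) ∧
    (∀ q : ℕ, q.Prime → ¬ q ∣ Nplus * Nminus * p →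
        val (lam q - (W.frobeniusTrace q : F)) ≤ val (p : F) ^ (N + 1)) ∧
    val (lam p) = 1 ∧
    ∃ I ∈ rightIdealsLite O, IsCommensurablePrimeToLite O p I ∧ Φ I ≠ 0)

/-- The twisted conductor-one Gross period of the route decl (verbatim). -/
def period (K : Type) [Field K] [NumberField K] {a b : ℚ}
    (ψ : K →ₐ[ℚ] QuaternionAlgebra ℚ a 0 b) (I₁ : Submodule ℤ (QuaternionAlgebra ℚ a 0 b))
    (a₀ : ClassGroup (𝓞 K) → nonZeroDivisors (Ideal (𝓞 K))) (α : ClassGroup (𝓞 K) → 𝓞 K)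
    (F : Type) [Field F] [Algebra K F] (e : Fin 2 → F) (k : ℕ)
    (Φ : Submodule ℤ (QuaternionAlgebra ℚ a 0 b) → MvPolynomial (Fin 2) F) : F :=
  ∑ c, (algebraMap K F (α c : K))⁻¹ ^ ((k - 2) / NumberField.classNumber K) *
    MvPolynomial.eval e (Φ (grossTranslateLite ψ (a₀ c).1 I₁))

/-- `DepthLE … P j₀`: "`2 (v_𝔓(P) - content Φ) ≤ j₀`" (verbatim). -/
def DepthLE (p : ℕ) {a b : ℚ} (O : Subring (QuaternionAlgebra ℚ a 0 b))
    (F : Type) [Field F] [NumberField F] (𝔓 : IsDedekindDomain.HeightOneSpectrum (𝓞 F))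
    (Φ : Submodule ℤ (QuaternionAlgebra ℚ a 0 b) → MvPolynomial (Fin 2) F) (P : F) (j₀ : ℕ) : Prop :=
  let val := 𝔓.valuation F
  ∀ I₀ ∈ rightIdealsLite O, IsCommensurablePrimeToLite O p I₀ → ∀ e₀ : Fin 2 → F,
    IsPrimitiveVecLite val e₀ → ∀ j : ℕ,
      val P ^ 2 ≤ val (MvPolynomial.eval e₀ (Φ I₀)) ^ 2 * val (p : F) ^ j → j ≤ j₀

/-- `DepthGE … P j₀`: "`2 (v_𝔓(P) - content Φ) ≥ j₀`" (verbatim). -/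
def DepthGE (p : ℕ) {a b : ℚ} (O : Subring (QuaternionAlgebra ℚ a 0 b))
    (F : Type) [Field F] [NumberField F] (𝔓 : IsDedekindDomain.HeightOneSpectrum (𝓞 F))
    (Φ : Submodule ℤ (QuaternionAlgebra ℚ a 0 b) → MvPolynomial (Fin 2) F) (P : F) (j₀ : ℕ) : Prop :=
  let val := 𝔓.valuation F
  ∃ I₀ ∈ rightIdealsLite O, IsCommensurablePrimeToLite O p I₀ ∧ ∃ e₀ : Fin 2 → F,
    IsPrimitiveVecLite val e₀ ∧ val P ^ 2 ≤ val (MvPolynomial.eval e₀ (Φ I₀)) ^ 2 * val (p : F) ^ j₀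

/-- The `∀ N` clause of the (quantifier-repaired) crux at a FIXED datum, with contact order `m`
and constant `C`: verbatim the tail of `Census.VerticalContactR`. -/
def ContactClause (W : WeierstrassCurve ℚ) [W.IsElliptic] [W.IsGloballyMinimal] (p : ℕ) [Fact p.Prime]
    (K : Type) [Field K] [NumberField K] (Nplus Nminus : ℕ) (a b : ℚ)
    (O : Subring (QuaternionAlgebra ℚ a 0 b)) (ψ : K →ₐ[ℚ] QuaternionAlgebra ℚ a 0 b)
    (I₁ : Submodule ℤ (QuaternionAlgebra ℚ a 0 b))
    (a₀ : ClassGroup (𝓞 K) → nonZeroDivisors (Ideal (𝓞 K))) (α : ClassGroup (𝓞 K) → 𝓞 K)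
    (m C : ℕ) : Prop :=
  ∀ N : ℕ, ∃ (F : Type) (_ : Field F) (_ : NumberField F) (_ : Algebra K F)
    (𝔓 : IsDedekindDomain.HeightOneSpectrum (𝓞 F))
    (ι : QuaternionAlgebra ℚ a 0 b →ₐ[ℚ] Matrix (Fin 2) (Fin 2) F) (e e' : Fin 2 → F)
    (k : ℕ) (lam : ℕ → F) (Φ : Submodule ℤ (QuaternionAlgebra ℚ a 0 b) → MvPolynomial (Fin 2) F),
    Form W p K Nplus Nminus a b O ψ N F 𝔓 ι e e' k lam Φ ∧
    DepthLE p O F 𝔓 Φ (period K ψ I₁ a₀ α F e k Φ) (2 * m * (N + 1) + C)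

/-! ### §1 Card `first-layer-depth` — one value bounds a `p`-adic order of vanishing -/

/-- **Ultrametric Taylor bound.** For an INTEGRAL `p`-adic power series `∑ bₙ Xⁿ` whose first
`m` coefficients vanish and any `x ∈ ℤ_[p]`: `‖∑ bₙ xⁿ‖ ≤ ‖x‖ ^ m` (no summability hypothesis
is needed: the junk value `0` of a non-summable `tsum` satisfies the bound). -/
theorem norm_tsum_mul_pow_le {p : ℕ} [Fact p.Prime] (b : ℕ → ℤ_[p]) (x : ℤ_[p]) (m : ℕ)
    (hb : ∀ n < m, b n = 0) : ‖∑' n, b n * x ^ n‖ ≤ ‖x‖ ^ m := by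
  refine IsUltrametricDist.norm_tsum_le_of_forall_le_of_nonneg (by positivity) fun n => ?_
  by_cases hn : n < m
  · simp [hb n hn]
  · push_neg at hn
    calc ‖b n * x ^ n‖ ≤ ‖b n‖ * ‖x ^ n‖ := norm_mul_le _ _
      _ ≤ 1 * ‖x‖ ^ n := by
          gcongr
          · exact PadicInt.norm_le_one _
          · exact norm_pow_le x n
      _ ≤ ‖x‖ ^ m := by
          rw [one_mul]
          exact pow_le_pow_of_le_one (norm_nonneg _) (PadicInt.norm_le_one _) hn

/-- **One value bounds the order** (contrapositive): if the value at `x` is LARGER than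
`‖x‖^(m+1)` then one of `b₀, …, b_m` is non-zero, i.e. `ord_{X=0} (∑ bₙ Xⁿ) ≤ m`.  With
`‖x‖ = p^{-(N+1)}` (an arithmetic weight at depth `N`) this reads: depth of ONE value
`< (m+1)(N+1)` forces contact order `≤ m`. -/
theorem exists_coeff_ne_zero_of_pow_lt_norm_tsum {p : ℕ} [Fact p.Prime] (b : ℕ → ℤ_[p])
    (x : ℤ_[p]) (m : ℕ) (h : ‖x‖ ^ (m + 1) < ‖∑' n, b n * x ^ n‖) : ∃ n ≤ m, b n ≠ 0 := by
  by_contra hcon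
  push_neg at hcon
  have hle := norm_tsum_mul_pow_le b x (m + 1) (fun n hn => hcon n (by omega))
  exact absurd h (not_lt.mpr hle)

/-- The weight parameter of an arithmetic weight `k` in the `Λ = ℤ_[p]⟦X⟧`-variable:
`x_k = (1+p)^{k-2} - 1`, of valuation `1 + v_p(k-2)` for odd `p`. -/
def weightParam (p : ℕ) [Fact p.Prime] (k : ℕ) : ℤ_[p] := (1 + (p : ℤ_[p])) ^ (k - 2) - 1

/-- **GermSupplyAt** (layer-2 supply, at a fixed datum): there is an INTEGRAL Iwasawa germ
`𝓙 = ∑ bₙ Xⁿ ∈ ℤ_[p]⟦X⟧` (the Λ-adic twisted Gross period of the Hida branch through `f_W` on the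
definite algebra, expanded at the weight-2 point — Hida's étaleness at arithmetic points makes `X`
a local parameter; primitivity of the Λ-adic eigenform (multiplicity one at the residual maximal
ideal, from `ρ̄` ramified at `q ∣ N⁻`) makes every content zero) such that at EVERY arithmetic
weight `k = 2 + 2(p-1)·h_K·p^N·t` an admissible depth-`N` form exists whose period has two-sided
`𝔓`-depth EXACTLY `2·v_p(𝓙(x_k))` whenever `𝓙(x_k) ≠ 0`.  (Longo–Vigni §§5–6, Castella–Kim–Longo
Thm 3.1/3.4, Hida 1986; this is the route's foreseen child `FamilySupply`, sharpened by
integrality + primitivity.) -/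
def GermSupplyAt (W : WeierstrassCurve ℚ) [W.IsElliptic] [W.IsGloballyMinimal] (p : ℕ) [Fact p.Prime]
    (K : Type) [Field K] [NumberField K] (Nplus Nminus : ℕ) (a b : ℚ)
    (O : Subring (QuaternionAlgebra ℚ a 0 b)) (ψ : K →ₐ[ℚ] QuaternionAlgebra ℚ a 0 b)
    (I₁ : Submodule ℤ (QuaternionAlgebra ℚ a 0 b))
    (a₀ : ClassGroup (𝓞 K) → nonZeroDivisors (Ideal (𝓞 K))) (α : ClassGroup (𝓞 K) → 𝓞 K) : Prop :=
  ∃ bcoef : ℕ → ℤ_[p], ∀ (N t : ℕ), 0 < t → Nat.Coprime t p →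
    let k := 2 + 2 * (p - 1) * NumberField.classNumber K * p ^ N * t
    let J := ∑' n, bcoef n * weightParam p k ^ n
    J ≠ 0 →
    ∃ (F : Type) (_ : Field F) (_ : NumberField F) (_ : Algebra K F)
      (𝔓 : IsDedekindDomain.HeightOneSpectrum (𝓞 F))
      (ι : QuaternionAlgebra ℚ a 0 b →ₐ[ℚ] Matrix (Fin 2) (Fin 2) F) (e e' : Fin 2 → F)
      (lam : ℕ → F) (Φ : Submodule ℤ (QuaternionAlgebra ℚ a 0 b) → MvPolynomial (Fin 2) F),
      Form W p K Nplus Nminus a b O ψ N F 𝔓 ι e e' k lam Φ ∧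
      DepthLE p O F 𝔓 Φ (period K ψ I₁ a₀ α F e k Φ) (2 * J.valuation) ∧
      DepthGE p O F 𝔓 Φ (period K ψ I₁ a₀ α F e k Φ) (2 * J.valuation)

/-- **FirstLayerDepthAt** (C⁺ at a fixed datum): at the FIRST layer (`N = 0`, a weight `k` with
`p ∤ k - 2`) some admissible form has twisted Gross period of `𝔓`-depth at most
`r_an(E) + r_an(E^{d_K})` — ONE classical central value, NO constant `C`. -/
def FirstLayerDepthAt (W : WeierstrassCurve ℚ) [W.IsElliptic] [W.IsGloballyMinimal] (p : ℕ)
    [Fact p.Prime] (K : Type) [Field K] [NumberField K] (Nplus Nminus : ℕ) (a b : ℚ)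
    (O : Subring (QuaternionAlgebra ℚ a 0 b)) (ψ : K →ₐ[ℚ] QuaternionAlgebra ℚ a 0 b)
    (I₁ : Submodule ℤ (QuaternionAlgebra ℚ a 0 b))
    (a₀ : ClassGroup (𝓞 K) → nonZeroDivisors (Ideal (𝓞 K))) (α : ClassGroup (𝓞 K) → 𝓞 K) : Prop :=
  ∃ (F : Type) (_ : Field F) (_ : NumberField F) (_ : Algebra K F)
    (𝔓 : IsDedekindDomain.HeightOneSpectrum (𝓞 F))
    (ι : QuaternionAlgebra ℚ a 0 b →ₐ[ℚ] Matrix (Fin 2) (Fin 2) F) (e e' : Fin 2 → F)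
    (k : ℕ) (lam : ℕ → F) (Φ : Submodule ℤ (QuaternionAlgebra ℚ a 0 b) → MvPolynomial (Fin 2) F),
    Form W p K Nplus Nminus a b O ψ 0 F 𝔓 ι e e' k lam Φ ∧ ¬ p ∣ k - 2 ∧
    DepthLE p O F 𝔓 Φ (period K ψ I₁ a₀ α F e k Φ)
      (W.analyticRank + (W.quadraticTwist (NumberField.discr K : ℚ)).analyticRank)

/-- **FirstLayerDepth** (the transferred crux C⁺, summit-quantified like the crux): for every
elliptic `E/ℚ` (global minimal `W`) with a multiplicative prime there is an admissible datum with
`r_an(E^{d_K}) ≤ 1` at which `FirstLayerDepthAt` holds. -/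
def FirstLayerDepth : Prop :=
  ∀ (W : WeierstrassCurve ℚ) [W.IsElliptic] [W.IsGloballyMinimal],
    (∃ (q : ℕ) (_ : Fact q.Prime), W.HasMultiplicativeReductionAtPrime q) →
    ∃ (p : ℕ) (_ : Fact p.Prime) (K : Type) (_ : Field K) (_ : NumberField K) (Nplus Nminus : ℕ)
      (a b : ℚ) (O : Subring (QuaternionAlgebra ℚ a 0 b)) (ψ : K →ₐ[ℚ] QuaternionAlgebra ℚ a 0 b)
      (I₁ : Submodule ℤ (QuaternionAlgebra ℚ a 0 b))
      (a₀ : ClassGroup (𝓞 K) → nonZeroDivisors (Ideal (𝓞 K))) (α : ClassGroup (𝓞 K) → 𝓞 K),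
      Datum W p K Nplus Nminus a b O ψ I₁ a₀ α ∧
      (W.quadraticTwist (NumberField.discr K : ℚ)).analyticRank ≤ 1 ∧
      GermSupplyAt W p K Nplus Nminus a b O ψ I₁ a₀ α ∧
      FirstLayerDepthAt W p K Nplus Nminus a b O ψ I₁ a₀ α

/-- **OneValueTransfer** (the line's transfer stub, `C⁺ → C` at a datum): germ supply + ONE
first-layer value of depth `≤ r̃_an` give the crux's whole `∀ N` clause with SOME contact order
`m`, `2m ≤ r̃_an`, and some constant `C` — by `exists_coeff_ne_zero_of_pow_lt_norm_tsum`
(order `≤` first-layer depth) and the eventual domination of the leading term (which supplies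
`C`; finitely many depths with a zero AT the sampled weight are dodged by the free parameter `t`). -/
def OneValueTransfer : Prop :=
  ∀ (W : WeierstrassCurve ℚ) [W.IsElliptic] [W.IsGloballyMinimal] (p : ℕ) [Fact p.Prime]
    (K : Type) [Field K] [NumberField K] (Nplus Nminus : ℕ) (a b : ℚ)
    (O : Subring (QuaternionAlgebra ℚ a 0 b)) (ψ : K →ₐ[ℚ] QuaternionAlgebra ℚ a 0 b)
    (I₁ : Submodule ℤ (QuaternionAlgebra ℚ a 0 b))
    (a₀ : ClassGroup (𝓞 K) → nonZeroDivisors (Ideal (𝓞 K))) (α : ClassGroup (𝓞 K) → 𝓞 K),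
    Datum W p K Nplus Nminus a b O ψ I₁ a₀ α →
    GermSupplyAt W p K Nplus Nminus a b O ψ I₁ a₀ α →
    FirstLayerDepthAt W p K Nplus Nminus a b O ψ I₁ a₀ α →
    ∃ m C : ℕ, 2 * m ≤ W.analyticRank + (W.quadraticTwist (NumberField.discr K : ℚ)).analyticRank ∧
      ContactClause W p K Nplus Nminus a b O ψ I₁ a₀ α m C

/-! ### §2 Card `hida-tangent-cup` — the two-refinement dichotomy (linear algebra, proved) -/

/-- **TwoRefinementDichotomy.** `T` = the (two-dimensional) space of first-order deformation
classes `H¹(G_{ℚ,Σ}, ad⁰ V_pE)`, spanned by the tangent vectors `ξα, ξβ` of the two refinement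
families (ordinary / critical slope); `A ξ` = the Bockstein (cup-product) pairing of `ξ` on the
Selmer group `S`.  If the cup class of `(P, Q)` is non-zero on SOME deformation direction, it is
non-zero on `ξα` or on `ξβ`. -/
def TwoRefinementDichotomy : Prop :=
  ∀ (F T S : Type) [Field F] [AddCommGroup T] [Module F T] [AddCommGroup S] [Module F S]
    (A : T →ₗ[F] S →ₗ[F] S →ₗ[F] F) (ξα ξβ : T),
    (∀ ξ : T, ξ ∈ Submodule.span F ({ξα, ξβ} : Set T)) →
    ∀ P Q : S, (∃ ξ : T, A ξ P Q ≠ 0) → A ξα P Q ≠ 0 ∨ A ξβ P Q ≠ 0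

theorem twoRefinementDichotomy_holds : TwoRefinementDichotomy := by
  intro F T S _ _ _ _ _ A ξα ξβ hspan P Q ⟨ξ, hξ⟩
  by_contra hcon
  push_neg at hcon
  obtain ⟨hα, hβ⟩ := hcon
  obtain ⟨u, v, huv⟩ := Submodule.mem_span_pair.mp (hspan ξ)
  apply hξ
  rw [← huv, map_add, map_smul, map_smul, LinearMap.add_apply, LinearMap.smul_apply,
    LinearMap.smul_apply, LinearMap.add_apply, LinearMap.smul_apply, LinearMap.smul_apply,
    hα, hβ, smul_zero, smul_zero, add_zero]

/-! ### §3 Card `diagonal-coleman-primitive` — Rubin identity ⇒ leading term = alternating height -/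

/-- **RubinLeadingTermIdentity.** If the weight-direction Bockstein pairing `A` (alternating) of
the explicit generalised Kato class `κ = c·(log Q · P − log P · Q)` (Castella–Hsieh Cor. 5.1)
against any Selmer class `x` equals `j · log x` (weight-direction Rubin formula, `j` = first
weight-derivative of the Λ-adic period), and `log P ≠ 0`, then `j = c · A P Q`: the leading term
IS the alternating weight height, up to the explicit non-zero constant `c`. -/
def RubinLeadingTermIdentity : Prop :=
  ∀ (F S : Type) [Field F] [AddCommGroup S] [Module F S]
    (A : LinearMap.BilinForm F S) (log : S →ₗ[F] F) (P Q κ : S) (c j : F),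
    (∀ x, A x x = 0) → κ = c • (log Q • P - log P • Q) → (∀ x, A κ x = j * log x) →
    log P ≠ 0 → j = c * A P Q

theorem rubinLeadingTermIdentity_holds : RubinLeadingTermIdentity := by
  intro F S _ _ _ A log P Q κ c j halt hκ hrubin hlogP
  have hskew : A Q P = -A P Q := by
    have h := halt (P + Q)
    simp only [map_add, LinearMap.add_apply, halt, zero_add, add_zero] at h
    linear_combination h
  have hP := hrubin P
  rw [hκ, map_smul, LinearMap.smul_apply, map_sub, LinearMap.sub_apply, map_smul, map_smul,
    LinearMap.smul_apply, LinearMap.smul_apply, halt P, hskew, smul_eq_mul, smul_eq_mul,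
    smul_eq_mul] at hP
  -- hP : c * (log Q * 0 - log P * -A P Q) = j * log P
  have h2 : (j - c * A P Q) * log P = 0 := by linear_combination -hP
  rcases mul_eq_zero.mp h2 with h | h
  · linear_combination h
  · exact absurd h hlogP

end Summit.BirchSwinnertonDyer.BirchSwinnertonDyer.Cruxes.VerticalContact.Ideate2
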